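import Literature.Claims.NS.Qiao2021
import HarnessLib

/-!
# Claim skeleton (D-0090 NS-CLAIMS, C40): D. T. Purvance, «On the convergence of periodic Navier-Stokes
# flows», arXiv:math/0610086 v14 (28 Aug 2008) — Fourier–Galerkin time series

Cell `ns-claims`, row C40 (T2; §0.2 queue v1.16), typist `ns-claims-typist-12` (lanes: refuter first idle
(PREDICTED-R), ref-2 g2, salvage by family (series: p6 / p2 g2), writer-2, lit-4 / lit-1 g4 renders). Text of
record (PINNED by ns-claims-lit-4, `pub/ns-claims/sources/Purvance2008/LOCATORS.md` §0): arXiv math/0610086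
**v14** (2008-08-28, 13 pp., PDF-only e-print; page = PDF page; displays read from `renders-lit1/p00N.png`),
bib `Purvance2008NSPeriodic`. The paper has NO theorem/lemma environments — its verbs are «argues» (abstract;
(29) p. 8; §5 p. 9). UNREFEREED CLAIM under adjudication — NOTHING in this file asserts a step: every
`Step_k`/`ClaimedTheorem` is a `Prop`; the `theorem`s are kernel compositions of the paper's own implications
and the Clay link. Card `pub/ns-claims/claims/Purvance2008/CARD.md` (PREDICTION §4 frozen 2026-08-27T00:06:30Z,
sha16 835e047ef6287b5d).

## Claimed statement (as printed)

Abstract: «any flow's unknown wavenumber coefficients can be solved for recursively … This paper argues that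
a solution's coefficients converge to these bounded Taylor coefficients when these bounds are evaluated with a
general solution's noncommutative matrices.» §5.0 p. 9, last sentence: **«The conclusion is that, as M, N → ∞,
u_n become the convergent time series solution coefficients to the continuous Navier-Stokes equations.»**
Setting §1.0 pp. 1–3: the Fourier-mode (Galerkin, `M = (L+1)³` modes) form (1)–(10) of 3D periodic
incompressible NS, `ν > 0`, no force, `du/dt = U(u)u`, `U = D + PJ(u)`; «Equation (4) becomes the continuous
periodic Navier-Stokes equations as M → ∞» (p. 3). §2.0: time-series ansatz (11) `u = Σ u_n tⁿ`, recursion (17)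
`u_n = (1/n) Σ_{p<n} U_{n−1−p} u_p`, (19)–(20) `u_n = S_n u₀`, `S_n = Σ_p s_{np} Π_{g∈G_{np}} U_g`. §3.0:
commutative-case exponential product (21), its Taylor coefficients `b_n = B_n u₀` taken «using a general
solution's noncommutative U_n» (22)–(25); «Because b is stable, B_n are bounded and converge to zero» (p. 7).
§4.0 (26)–(29) and §5 — below. Appendix pp. 10–13: «U_n are inherently stable» (no eigenvalue with positive
real part).

RENDERING of the claimed sentence: the (B)-type statement it is offered as (LOCATORS §1 Clay dictionary):
for every `ν > 0` and every smooth divergence-free lattice-periodic datum, smooth `u, p` on `ℝ³ × [0,∞)`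
solving (1)–(3) from `u₀` with `u(·,t)` periodic, AND `u` the sum of its time power series at `t = 0` for
every `t ≥ 0` («convergent time series solution coefficients»; the clause `IsTimeSeriesOn` of the C39
skeleton, reused). The PRINTED objects (Galerkin truncation, formal series, comparison series) live in the
Steps; the passage from them to this sentence is `Step_continuum`.

## Clay delta (reference `Literature.Claims.NS.ClayVariants`, axes Δ1–Δ8)

Nearest (B) `ClayVariants.clayPeriodic.Regularity`; `clay_of_claimed` PROVED (projection — the rendered
sentence is (B) plus the series clause). As PRINTED: Δ1/Δ4 finitely many modes (Galerkin; «=» (B) only after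
«M → ∞», one sentence p. 3), Δ5 formal power series in `t`, Δ6 «u_n become the convergent time series
solution coefficients» — no smooth `(u,p)`, no radius statement; these wrong-problem residues are carried by
`Step_continuum`.

## Steps — ORDERED INDEX (TYPING-HYGIENE 11; print order)

Step 1 = (17)–(20) pp. 4–5, the recursion `u_n = (1/n) Σ_{p<n} U_{n−1−p} u_p`, `u_n = S_n u₀` — formal
Cauchy-product calculus (quoted; not typed: the located inferences below do not use its specific form) ·
Step 2 = (21)–(25) pp. 5–7, the comparison coefficients `B_n` («Because b is stable, B_n are bounded and
converge to zero») — quoted · Step 3 = (26)–(28) p. 7: `S_n − B_n = Σ_r d_{nr} Π_{g∈G_{nr}} U_g` with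
`Σ_r d_{nr} = 0` (27) «true regardless of the commutativity properties of U_n»; (28): `u₃ − b₃ =
(1/3)(U₁U₀ − U₀U₁)u₀` — bookkeeping, quoted (it enters Step 4 as the hypothesis `Σ_r d_{nr} = 0`) · **Step 4 =
`Step_29`** ((29) p. 8: «lim_{n→∞}(S_n − B_n) = lim Σ_r d_{nr} ΠU_g = lim (Σ_r d_{nr})(Σ_r ΠU_g) = 0 is
reached if over r(n) d_{nr} and elements of matrices ΠU_g approach linear independence. Since coefficients
d_{nr} are the same for all flows, they must be independent of the specifics of any flow ΠU_g which argues
that (29) is true» — typed at the grain of the printed REASON: fixed scalars summing to zero against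
ARBITRARY matrix families ⇒ the combination tends to zero; the displayed factorisation is `Step_29Factor`;
typist's flag: suspicious) · **Step 5 = `Step_conv`** (§5 p. 9: «Consequently, as n gets large, S_n − B_n → 0,
and solution transformations S_n converge onto bounded transformations B_n» read, as the abstract announces,
as convergence of the solution series: termwise `S_n − B_n → 0` and convergence of `Σ B_n tⁿ` for all `t` ⇒
convergence of `Σ S_n tⁿ` for all `t`; abstract sequence grain; typist's flag: suspicious) · **Step 6 =
`Step_continuum`** (p. 3 «(4) becomes the continuous periodic Navier-Stokes equations as M → ∞» + p. 9 last
sentence «as M, N → ∞, u_n become the convergent time series solution coefficients to the continuous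
Navier-Stokes equations»: typed as the printed implication from Steps 4–5 to the claimed sentence; typist's
flag: suspicious (no estimate uniform in M; no passage from coefficients to a smooth solution)).

## COMPOSITION — proved as `claim_of_steps`

`claim_of_steps : Step_29 → Step_conv → Step_continuum → ClaimedTheorem` — PROVED (modus ponens through the
printed continuum sentence). `clay_of_claimed : ClaimedTheorem → ClayVariants.clayPeriodic.Regularity` PROVED.

Design notes. Matrices are `Matrix (Fin m) (Fin m) ℂ` for arbitrary `m` (the paper's `3M × 3M` complex
matrices); limits are ENTRYWISE (`Tendsto … (𝓝 0)` per entry) and series convergence is entrywise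
`Summable` — no matrix norm instance is introduced (TYPER LINT). Finite index families `r ∈ range (k n)`.
`IsTimeSeriesOn` is imported from the C39 skeleton (`Literature.Claims.NS.Qiao2021`), not re-declared.

WHAT THIS IS NOT: not a claim about NS regularity or blow-up; not a claim about any author beyond the
typed locator.
-/

noncomputable section

open Set Function Filter Finset
open scoped Topology BigOperators ContDiff
open Literature.Analysis.FluidPDE
open Literature.Claims.NS.Qiao2021 (E3 IsTimeSeriesOn)

namespace Literature.Claims.NS.Purvance2008

/-! ### The claimed statement -/

/-- **The claimed sentence (§5.0 p. 9, last sentence; abstract), rendered as the (B)-type statement it is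
offered as**: for every `ν > 0` and every smooth divergence-free lattice-periodic datum `u₀` there are smooth
`u, p` on `ℝ³ × [0,∞)` solving Navier–Stokes from `u₀` with `u(·,t)` periodic for `t ≥ 0` (the Clay (B)
solution notion of `ClayVariants.clayPeriodic`), and `u` is the sum of its time power series at `t = 0` for
every `t ≥ 0` («u_n become the convergent time series solution coefficients to the continuous Navier-Stokes
equations»). [cite: Purvance2008NSPeriodic, §5.0 p. 9; abstract p. 1] -/
def ClaimedTheorem : Prop :=
  ∀ ν : ℝ, 0 < ν → ∀ u₀ : E3 → E3, ContDiff ℝ ∞ u₀ → NSWave0.IsDivFree u₀ → IsLatticePeriodic u₀ →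
    ∃ (u : ℝ → E3 → E3) (p : ℝ → E3 → ℝ),
      IsSmoothOnHalfSpace u ∧ IsSmoothOnHalfSpace p ∧ IsNavierStokesSolution ν 0 u₀ u p ∧
        (∀ t : ℝ, 0 ≤ t → IsLatticePeriodic (u t)) ∧ IsTimeSeriesOn (Ici 0) u₀ u

/-- **Clay link (TYPING-HYGIENE 10(a))**: the claimed sentence implies Clay (B)
`ClayVariants.clayPeriodic.Regularity` (drop the series clause). PROVED.
[cite: Purvance2008NSPeriodic, §5.0 p. 9] -/
theorem clay_of_claimed (h : ClaimedTheorem) : ClayVariants.clayPeriodic.Regularity := by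
  intro ν hν u₀ hsmooth hdiv hper
  obtain ⟨u, p, hu, hp, hns, hperu, -⟩ := h ν hν u₀ hsmooth hdiv hper
  exact ⟨u, p, hu, hp, hns, hperu⟩

/-! ### The steps (abstract matrix / series grain of §§4–5) -/

/-- **Step 4 — display (29) p. 8**: «Convergence in the limit lim_{n→∞}(S_n − B_n) = lim_{r(n)→∞} Σ_r d_{nr}
Π_{g∈G_{nr}} U_g = lim_{r(n)→∞} (Σ_r d_{nr}) (Σ_r Π_{g∈G_{nr}} U_g) = 0 (29) is reached if over r(n) d_{nr} and
elements of matrices Π U_g approach linear independence. Since coefficients d_{nr} are the same for all flows,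
they must be independent of the specifics of any flow Π U_g which argues that (29) is true.» TYPED at the
grain of the printed reason: for every dimension, every sequence of finite families of FIXED scalars with
`Σ_r d_{nr} = 0` ((27)) and EVERY family of matrices `X_{nr}` (the flow-dependent products), the combination
`Σ_r d_{nr} X_{nr}` tends to zero entrywise. Typist's flag: suspicious ((28) itself: `u₃ − b₃ =
(1/3)(U₁U₀ − U₀U₁)u₀`). [cite: Purvance2008NSPeriodic, (29) p. 8; (26)–(28) p. 7] -/
def Step_29 : Prop :=
  ∀ (m : ℕ) (k : ℕ → ℕ) (d : ℕ → ℕ → ℂ) (X : ℕ → ℕ → Matrix (Fin m) (Fin m) ℂ),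
    (∀ n, ∑ r ∈ range (k n), d n r = 0) →
      ∀ i j : Fin m, Tendsto (fun n => (∑ r ∈ range (k n), d n r • X n r) i j) atTop (𝓝 0)

/-- **Step 4, the displayed factorisation in (29) p. 8**: «Σ_r d_{nr} Π U_g = (Σ_r d_{nr})(Σ_r Π U_g)» (the
middle equality of (29), «reached if … approach linear independence»), typed as the identity of finite sums
it displays, for arbitrary scalars and matrices. Typist's flag: suspicious.
[cite: Purvance2008NSPeriodic, (29) p. 8] -/
def Step_29Factor : Prop :=
  ∀ (m k : ℕ) (d : ℕ → ℂ) (X : ℕ → Matrix (Fin m) (Fin m) ℂ),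
    ∑ r ∈ range k, d r • X r = (∑ r ∈ range k, d r) • ∑ r ∈ range k, X r

/-- **Step 5 — §5.0 p. 9**: «Consequently, as n gets large, S_n − B_n → 0, and solution transformations S_n
converge onto bounded transformations B_n. The conclusion is that … u_n become the convergent time series
solution coefficients» (with p. 7 «B_n are bounded and converge to zero», p. 6 «time series b converges»):
termwise `S_n − B_n → 0` and convergence of the comparison series `Σ B_n tⁿ` for every `t` ⇒ convergence of the
solution series `Σ S_n tⁿ` for every `t` (entrywise). TYPED at the abstract sequence grain. Typist's flag:
suspicious. [cite: Purvance2008NSPeriodic, §5.0 p. 9; p. 6–7] -/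
def Step_conv : Prop :=
  ∀ (m : ℕ) (S B : ℕ → Matrix (Fin m) (Fin m) ℂ),
    (∀ i j : Fin m, Tendsto (fun n => (S n - B n) i j) atTop (𝓝 0)) →
    (∀ t : ℝ, ∀ i j : Fin m, Summable (fun n => ((t : ℂ) ^ n • B n) i j)) →
      ∀ t : ℝ, ∀ i j : Fin m, Summable (fun n => ((t : ℂ) ^ n • S n) i j)

/-- **Step 6 — the continuum passage**: p. 3 «Equation (4) becomes the continuous periodic Navier-Stokes
equations as M → ∞» and p. 9 «The conclusion is that, as M, N → ∞, u_n become the convergent time series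
solution coefficients to the continuous Navier-Stokes equations» — TYPED as the printed implication: the
§4–§5 inferences (Steps 4–5) ⇒ the claimed sentence. Typist's flag: suspicious (no estimate uniform in the
truncation `M`; «convergent coefficients» are not turned into a smooth solution; Δ1/Δ4/Δ5/Δ6).
[cite: Purvance2008NSPeriodic, p. 3; §5.0 p. 9] -/
def Step_continuum : Prop :=
  Step_29 → Step_conv → ClaimedTheorem

/-! ### Kernel relations -/

/-- **KERNEL COMPOSITION** — the claimed sentence from the printed chain: (29) + the §5 transfer + the
continuum sentence; modus ponens. [cite: Purvance2008NSPeriodic, §§4–5 pp. 7–9] -/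
theorem claim_of_steps (h29 : Step_29) (hconv : Step_conv) (hcont : Step_continuum) : ClaimedTheorem :=
  hcont h29 hconv

end Literature.Claims.NS.Purvance2008

end
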